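import Literature.NumberTheory.ModularForms.HeckeRingGLnZetaFunction
import Literature.LinearAlgebra.Subspace.GaussianBinomialCount
import Literature.AlgebraicGeometry.HodgeTheory.AbelianVarietySubgroupsOfOrderN
import HarnessLib

/-!
# The sublattices of index `pʲ` of `ℤⁿ` number the Gaussian binomial `[n+j−1; j]_p`, and `f_n(m) = ∏_{pʲ ∥ m} [n+j−1; j]_p = ∏_{pʲ∥m} ∏_{i=1}^{j} (p^{n+i−1} − 1)/(pⁱ − 1)` (Zou, *Gaussian binomials and the number of sublattices*, Acta Cryst. A62 (2006); Gruber 1997)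

Layer `Literature/NumberTheory/ModularForms`, namespace `Literature.NumberTheory.ModularForms` (§4's abelian-variety corollaries in
`Literature.AlgebraicGeometry.HodgeTheory.AbelianVariety`).  THEOREMS ONLY (no definition, no named fact, no instance, no notation; D-0026 net debt 0).  Sequel of the
lane's `HeckeRingGLnZetaFunction` (Andrianov–Zhuravlev Problem 2.10: `f_n(m) := #{K ≤ ℤⁿ : [ℤⁿ : K] = m} = (ζ ⋆ id ⋆ ⋯ ⋆ idⁿ⁻¹)(m)`, `Σ f_n(m) m⁻ˢ = ζ(s)⋯ζ(s−n+1)`) and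
of the tree's Gaussian binomial `qBinomial` (`Combinatorics/Enumerative/QPfaffSaalschutz`, Cohn's closed form in `LinearAlgebra/Subspace/GaussianBinomialCount`): the
PRIME-POWER values of `f_n` in closed form, which the tree had only for `j = 1` (`1 + p + ⋯ + p^{n−1}`, `HodgeTheory/AbelianVarietyPrimeIndexSublattices`) and for
`n = 2` (`σ₁(pʲ)`, Serre (65)).

THE PRINT (held text `paper:arxiv-math_0610684`, verbatim).  Y. M. Zou [Zou2006], §1: «To determine the number `f_n(m)` (notation as in Baake (1997)) of sublattices of
index `m` in an `n`-dimensional lattice is the same as to determine the number of subgroups of index `m` in a free abelian group of rank `n`. … (1.1)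
`f_n(m) = Σ_{d₁d₂⋯d_n = m} d₁⁰ d₂¹ ⋯ d_n^{n−1}`, … (1.2) `F_n(s) = ζ(s)ζ(s−1)⋯ζ(s−n+1)` … Gruber (1997) proved that if `m = p₁^{r₁}⋯p_k^{r_k}` is the prime factorization of
`m`, then `f_n(m)` can also be computed by the following formula: (1.4) `f_n(m) = ∏ᵢ ∏_{j=1}^{rᵢ} (pᵢ^{n+j−1} − 1)/(pᵢ^j − 1) = ∏ᵢ ∏_{j=1}^{n−1} (pᵢ^{rᵢ+j} − 1)/(pᵢ^j − 1)`.»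
§2: «(2.5) `∏_{k=0}^{n−1} 1/(1 − qᵏt) = Σ_{k≥0} [[n+k−1; k]]_q tᵏ`.  Now since (2.6) `F_n(s) = ∏_{i=0}^{n−1} ζ(s−i) = ∏_p ∏_{k=0}^{n−1} 1/(1 − p^{−s+k}) = ∏_p Σ_k [[n+k−1;
k]]_p p^{−sk} = Σ_m ∏ᵢ [[n+kᵢ−1; kᵢ]]_{pᵢ} / mˢ`, where `m = p₁^{k₁}⋯`, we obtain the first formula in (1.4), and applying (2.3) [`[[m;k]] = [[m; m−k]]`], we obtain the
second formula in (1.4).»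

## What is proved (`p` prime; rank written `n = k + 1 ≥ 1`)

* §1 **`qBinomial_succ_add_eq_sum`**: `[k+1+j; k+1]_q = Σ_{i≤j} q^{(k+1)(j−i)} [k+i; k]_q` (the coefficient recursion of (2.5)); `qBinomial_succ_one_eq_sum`: `[j+1; 1]_q = Σ_{i≤j} qⁱ`.
* §2 **`prod_pow_apply_prime_pow`**: `(ζ ⋆ id ⋆ ⋯ ⋆ idᵏ)(pʲ) = [k+j; k]_p` ((2.6), coefficient of `p^{−sj}`).
* §3 **`natCard_addSubgroup_pi_int_index_eq_prime_pow_eq_qBinomial`** (`'`): `f_{k+1}(pʲ) = [k+j; k]_p = [k+j; j]_p`;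
  **`natCard_addSubgroup_pi_int_index_eq_factorization_prod_qBinomial`**: `f_{k+1}(m) = ∏_{pʲ∥m} [k+j; k]_p` (first formula of (1.4));
  **`qBinomial_add_mul_prod_eq_prod`**: `[k+j; k]_q ∏_{i=1}^{j}(qⁱ − 1) = ∏_{i=1}^{j}(q^{k+i} − 1)` (Gruber's product, division-free).
* §4 free abelian groups of rank `k+1` (`_of_free`), lattices `Γ ⊂ ℂ` (`Σ_{i≤j} pⁱ` sublattices of index `pʲ`), and complex abelian varieties:
  **`AbelianVariety.natCard_subgroup_points_natCard_eq_prime_pow_eq_qBinomial`**: a complex abelian variety of dimension `g ≥ 1` has `[2g−1+j; 2g−1]_p` subgroups of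
  order `pʲ`; `g = 1`: `1 + p + ⋯ + pʲ`.

## References

* [Zou2006] Y. M. Zou, *Gaussian binomials and the number of sublattices*, Acta Cryst. A62 (2006) 409–410, arXiv:math/0610684 — §1 (1.1)–(1.4), §2 (2.3)–(2.6).
* [AndrianovZhuravlev2015] A. N. Andrianov, V. G. Zhuravlev, *Modular Forms and Hecke Operators* — Ch. 3 §2 Problem 2.10 (via the lane's `HeckeRingGLnZetaFunction`).
* [Cohn2004] H. Cohn, *Projective geometry over 𝔽₁ and the Gaussian binomial coefficients* — §2 (3) (via the tree's `qBinomial_mul_prod_eq_prod`, `qBinomial_symm`).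
* [Serre1973] J.-P. Serre, *A Course in Arithmetic* — Ch. VII §5.2 (65) (rank 2: `σ₁(pʲ)`).
* [Lange2023AbelianVarietiesComplex] H. Lange — §1.1.2 Prop. 1.1.14 (via the tree's `natCard_subgroup_points_natCard_eq_eq_prod_pow_apply`).

lit-hodgefound prover seat p21, generation 49, row g49-#16 (own row, claimed by path; sequel of g49-#1).
-/

noncomputable section

open Finset ArithmeticFunction
open Literature.Combinatorics.Enumerative
open Literature.LinearAlgebra.Subspace

namespace Literature.NumberTheory.ModularForms

/-! ### §1 `[k+1+j; k+1]_q = Σ_{i ≤ j} q^{(k+1)(j−i)} [k+i; k]_q` -/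

/-- **`[k+1+j; k+1]_q = Σ_{i=0}^{j} q^{(k+1)(j−i)} [k+i; k]_q`** (iterate the `q`-Pascal rule `[L+1, k+1] = q^{k+1}[L, k+1] + [L, k]`): the prime-power recursion
`f_{n+1}(pʲ) = Σ_{i ≤ j} f_n(pⁱ) p^{n(j−i)}` of the sublattice counts, on the Gaussian side («`∏_{k=0}^{n−1} 1/(1 − qᵏt) = Σ_k [[n+k−1; k]]_q tᵏ`» (2.5)).
[cite: Zou2006, §2 (2.5)–(2.6)] -/
theorem qBinomial_succ_add_eq_sum {R : Type*} [CommRing R] (q : R) (k j : ℕ) :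
    qBinomial q (k + 1 + j) (k + 1) = ∑ i ∈ range (j + 1), q ^ ((k + 1) * (j - i)) * qBinomial q (k + i) k := by
  induction j with
  | zero => simp
  | succ j ih =>
    rw [show k + 1 + (j + 1) = (k + 1 + j) + 1 by ring, qBinomial_succ_succ, ih, sum_range_succ _ (j + 1), Nat.sub_self, mul_zero, pow_zero, one_mul,
      show k + 1 + j = k + (j + 1) by ring, mul_sum]
    congr 1
    refine sum_congr rfl fun i hi => ?_
    rw [mem_range] at hi
    rw [show j + 1 - i = (j - i) + 1 by omega]
    ring

/-! ### §2 `(ζ ⋆ id ⋆ ⋯ ⋆ idᵏ)(pʲ) = [k+j; k]_p` -/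

/-- The product `ζ ⋆ id ⋆ ⋯ ⋆ idⁿ⁻¹` is multiplicative. [folklore] -/
private theorem isMultiplicative_prod_pow (n : ℕ) : IsMultiplicative (∏ i ∈ range n, (pow i : ArithmeticFunction ℕ)) := by
  induction n with
  | zero => rw [range_zero, prod_empty]; exact isMultiplicative_one
  | succ n ih => rw [prod_range_succ]; exact ih.mul isMultiplicative_pow

/-- **`(ζ ⋆ id ⋆ ⋯ ⋆ idᵏ)(pʲ) = [k+j; k]_p`** for a prime `p` («`F_n(s) = ∏_{i=0}^{n−1} ζ(s−i) = ∏_p ∏_{k=0}^{n−1} 1/(1 − p^{−s+k}) = ∏_p Σ_k [[n+k−1; k]]_p p^{−sk}`»;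
here `n = k + 1`, by induction on `k` through `(f ⋆ id^{k+1})(pʲ) = Σ_{i≤j} f(pⁱ) p^{(k+1)(j−i)}` and §1). [cite: Zou2006, §2 (2.6)] -/
theorem prod_pow_apply_prime_pow {p : ℕ} (hp : p.Prime) (k j : ℕ) :
    (((∏ i ∈ range (k + 1), (pow i : ArithmeticFunction ℕ)) (p ^ j) : ℕ) : ℤ) = qBinomial (p : ℤ) (k + j) k := by
  induction k generalizing j with
  | zero =>
    rw [zero_add, prod_range_one, pow_zero_eq_zeta, zeta_apply_ne (pow_ne_zero j hp.ne_zero), zero_add, qBinomial_zero_right, Nat.cast_one]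
  | succ k ih =>
    rw [prod_range_succ, mul_apply, Nat.sum_divisorsAntidiagonal fun a b => (∏ i ∈ range (k + 1), (pow i : ArithmeticFunction ℕ)) a * pow (k + 1) b,
      Nat.divisors_prime_pow hp j, sum_map, Nat.cast_sum, show k + 1 + j = k + 1 + j from rfl, qBinomial_succ_add_eq_sum]
    refine sum_congr rfl fun i hi => ?_
    rw [mem_range] at hi
    have hij : i ≤ j := Nat.le_of_lt_succ hi
    rw [Function.Embedding.coeFn_mk, Nat.pow_div hij hp.pos, pow_apply, if_neg (fun h => Nat.succ_ne_zero k h.1), Nat.cast_mul, ih i, ← pow_mul,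
      Nat.cast_pow, mul_comm, mul_comm (j - i)]

/-! ### §3 The sublattices of `ℤⁿ` of index `pʲ` number `[n−1+j; n−1]_p = [n+j−1; j]_p`; `f_n(m) = ∏_{pʲ∥m} [n+j−1; j]_p` -/

/-- **ZOU / GRUBER: the subgroups of index `pʲ` of `ℤ^{k+1}` number `[k+j; k]_p`** (`p` prime): «To determine the number `f_n(m)` … of sublattices of index `m` in an
`n`-dimensional lattice is the same as to determine the number of subgroups of index `m` in a free abelian group of rank `n` … `F_n(s) = ζ(s)ζ(s−1)⋯ζ(s−n+1)` …
we obtain the first formula in (1.4)», `f_n(m) = ∏ᵢ [[n+kᵢ−1; kᵢ]]_{pᵢ}` (`m = ∏ pᵢ^{kᵢ}`).  The Dirichlet-series count is the lane's `HeckeRingGLnZetaFunction`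
(`#{K ≤ ℤⁿ : [ℤⁿ : K] = m} = (ζ ⋆ id ⋆ ⋯ ⋆ idⁿ⁻¹)(m)`, Andrianov–Zhuravlev Problem 2.10). [cite: Zou2006, §1 (1.1)–(1.2), (1.4) and §2 (2.6)]
[cite: AndrianovZhuravlev2015, Ch. 3 §2 Problem 2.10] -/
theorem natCard_addSubgroup_pi_int_index_eq_prime_pow_eq_qBinomial {p : ℕ} (hp : p.Prime) (k j : ℕ) :
    (Nat.card {K : AddSubgroup (Fin (k + 1) → ℤ) // K.index = p ^ j} : ℤ) = qBinomial (p : ℤ) (k + j) k := by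
  rw [natCard_addSubgroup_pi_int_index_eq_prod_pow (k + 1) (pow_ne_zero j hp.ne_zero), prod_pow_apply_prime_pow hp k j]

/-- The same in Zou's indexing **`f_n(pʲ) = [[n+j−1; j]]_p`** (`n = k + 1`; `[k+j; k] = [k+j; j]`). [cite: Zou2006, §1 (1.4), §2 (2.3), (2.6)] -/
theorem natCard_addSubgroup_pi_int_index_eq_prime_pow_eq_qBinomial' {p : ℕ} (hp : p.Prime) (k j : ℕ) :
    (Nat.card {K : AddSubgroup (Fin (k + 1) → ℤ) // K.index = p ^ j} : ℤ) = qBinomial (p : ℤ) (k + j) j := by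
  rw [natCard_addSubgroup_pi_int_index_eq_prime_pow_eq_qBinomial hp, ← qBinomial_symm _ (Nat.le_add_left j k), Nat.add_sub_cancel]

/-- **`f_n(m) = ∏_{pʲ ∥ m} [n+j−1; j]_p = ∏_{pʲ∥m} [n−1+j; n−1]_p`** (`n = k+1 ≥ 1`, `m ≥ 1`): the count is multiplicative in `m` (it is `(ζ ⋆ id ⋆ ⋯ ⋆ idⁿ⁻¹)(m)`) with the
prime-power values above — «then `f_n(m)` can also be computed by the following formula: `f_n(m) = ∏ᵢ ∏_{j=1}^{rᵢ} (pᵢ^{n+j−1} − 1)/(pᵢ^j − 1)`» (1.4).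
[cite: Zou2006, §1 (1.4), §2] [cite: AndrianovZhuravlev2015, Ch. 3 §2 Problem 2.10] -/
theorem natCard_addSubgroup_pi_int_index_eq_factorization_prod_qBinomial (k : ℕ) {m : ℕ} (hm : m ≠ 0) :
    (Nat.card {K : AddSubgroup (Fin (k + 1) → ℤ) // K.index = m} : ℤ) = m.factorization.prod fun p j => qBinomial (p : ℤ) (k + j) k := by
  rw [natCard_addSubgroup_pi_int_index_eq_prod_pow (k + 1) hm, (isMultiplicative_prod_pow (k + 1)).multiplicative_factorization _ hm, Nat.cast_finsuppProd]
  refine Finsupp.prod_congr fun p hp => ?_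
  exact prod_pow_apply_prime_pow (Nat.prime_of_mem_primeFactors (by rwa [Nat.support_factorization] at hp)) k _

/-- `∏_{i<j} (1 − x_i) = (−1)^j ∏_{i<j} (x_i − 1)`. [folklore] -/
private theorem prod_range_one_sub_eq_neg_one_pow_mul' {R : Type*} [CommRing R] (f : ℕ → R) (j : ℕ) :
    ∏ i ∈ range j, (1 - f i) = (-1) ^ j * ∏ i ∈ range j, (f i - 1) := by
  induction j with
  | zero => simp
  | succ j ih => rw [prod_range_succ, prod_range_succ, ih]; ring

/-- **GRUBER'S PRODUCT (1.4), division-free: `[k+j; k]_q · ∏_{i=1}^{j} (qⁱ − 1) = ∏_{i=1}^{j} (q^{k+i} − 1)`** (so `f_{k+1}(pʲ) = ∏_{i=1}^{j} (p^{k+i} − 1)/(pⁱ − 1)`, Zou's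
«`f_n(m) = ∏ᵢ ∏_{j=1}^{rᵢ} (pᵢ^{n+j−1} − 1)/(pᵢ^j − 1)`» with `n = k + 1`); from Cohn's closed form `qBinomial_mul_prod_eq_prod`. [cite: Zou2006, §1 (1.4) (Gruber 1997)]
[cite: Cohn2004, §2 (3)] -/
theorem qBinomial_add_mul_prod_eq_prod {R : Type*} [CommRing R] (q : R) (k j : ℕ) :
    qBinomial q (k + j) k * ∏ i ∈ range j, (q ^ (i + 1) - 1) = ∏ i ∈ range j, (q ^ (k + i + 1) - 1) := by
  have key := qBinomial_mul_prod_eq_prod q (Nat.le_add_left j k)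
  rw [← qBinomial_symm q (Nat.le_add_left j k), Nat.add_sub_cancel, prod_range_one_sub_eq_neg_one_pow_mul',
    prod_range_one_sub_eq_neg_one_pow_mul' (fun i => q ^ (k + j - i)), mul_left_comm] at key
  have hu : IsUnit ((-1 : R) ^ j) := (isUnit_one.neg).pow j
  rw [hu.mul_left_cancel key, ← prod_range_reflect (fun i => q ^ (k + i + 1) - 1) j]
  refine prod_congr rfl fun i hi => ?_
  rw [mem_range] at hi
  congr 2
  omega

/-- `[j+1; 1]_q = 1 + q + ⋯ + qʲ` (the case `k = 0` of §1: rank one, `f_1(pʲ) = 1`… and rank two `f_2(pʲ) = 1 + p + ⋯ + pʲ = σ₁(pʲ)/…`). [cite: Zou2006, §2 (2.5)] -/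
theorem qBinomial_succ_one_eq_sum {R : Type*} [CommRing R] (q : R) (j : ℕ) : qBinomial q (j + 1) 1 = ∑ i ∈ range (j + 1), q ^ i := by
  have h := qBinomial_succ_add_eq_sum q 0 j
  rw [zero_add, add_comm] at h
  rw [h, ← sum_range_reflect (fun i => q ^ i) (j + 1)]
  refine sum_congr rfl fun i _ => ?_
  simp only [one_mul, zero_add, qBinomial_zero_right, mul_one, Nat.add_sub_cancel]

/-! ### §4 Free abelian groups of rank `n`, lattices, and complex abelian varieties -/

/-- **A free abelian group of rank `k + 1` has `[k+j; k]_p` subgroups of index `pʲ`.** [cite: Zou2006, §1 («the number of subgroups of index `m` in a free abelian group of rank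
`n`»), (1.4)] -/
theorem natCard_addSubgroup_index_eq_prime_pow_eq_qBinomial_of_free (M : Type*) [AddCommGroup M] [Module.Free ℤ M] [Module.Finite ℤ M] {p : ℕ} (hp : p.Prime)
    {k : ℕ} (hM : Module.finrank ℤ M = k + 1) (j : ℕ) :
    (Nat.card {K : AddSubgroup M // K.index = p ^ j} : ℤ) = qBinomial (p : ℤ) (k + j) k := by
  rw [natCard_addSubgroup_index_eq_prod_pow_of_free M (pow_ne_zero j hp.ne_zero), hM, prod_pow_apply_prime_pow hp]

/-- **A lattice `Γ ⊂ ℂ` has `[j+1; 1]_p = 1 + p + ⋯ + pʲ` sublattices of index `pʲ`** (`= σ₁(pʲ)`; rank `2`). [cite: Zou2006, §1 (1.4)] [cite: Serre1973, Ch. VII §5.2 (65)] -/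
theorem natCard_addSubgroup_index_eq_prime_pow_of_isZLattice (Γ : Submodule ℤ ℂ) [DiscreteTopology Γ] [IsZLattice ℝ Γ] {p : ℕ} (hp : p.Prime) (j : ℕ) :
    (Nat.card {K : AddSubgroup Γ // K.index = p ^ j} : ℤ) = ∑ i ∈ range (j + 1), (p : ℤ) ^ i := by
  rw [natCard_addSubgroup_index_eq_prime_pow_eq_qBinomial_of_free Γ hp (k := 1) (by rw [ZLattice.rank ℝ Γ, Complex.finrank_real_complex]) j, add_comm,
    qBinomial_succ_one_eq_sum]

end Literature.NumberTheory.ModularForms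

namespace Literature.AlgebraicGeometry.HodgeTheory.AbelianVariety

open Literature.NumberTheory.ModularForms
open scoped MonObj

variable (A : Literature.AlgebraicGeometry.Motives.AbelianVariety ℂ)

/-- **A COMPLEX ABELIAN VARIETY OF DIMENSION `g ≥ 1` HAS EXACTLY `[2g−1+j; 2g−1]_p = [2g+j−1; j]_p` SUBGROUPS OF ORDER `pʲ`** (`p` prime): they are as many as the sublattices of
index `pʲ` of `H₁(A(ℂ); ℤ) ≅ ℤ^{2g}` (the tree's `natCard_subgroup_points_natCard_eq_eq_prod_pow_apply`), counted by Zou/Gruber; for `g = 1`: `1 + p + ⋯ + pʲ`.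
[cite: Zou2006, §1 (1.4), §2 (2.6)] [cite: Lange2023AbelianVarietiesComplex, §1.1.2 Prop. 1.1.14] -/
theorem natCard_subgroup_points_natCard_eq_prime_pow_eq_qBinomial {p : ℕ} (hp : p.Prime) (hA : 0 < A.dim) (j : ℕ) :
    (Nat.card {H : Subgroup (A.Points ℂ) // Nat.card H = p ^ j} : ℤ) = qBinomial (p : ℤ) (2 * A.dim - 1 + j) (2 * A.dim - 1) := by
  rw [natCard_subgroup_points_natCard_eq_eq_prod_pow_apply A (pow_ne_zero j hp.ne_zero)]
  obtain ⟨r, hr⟩ : ∃ r, 2 * A.dim = r + 1 := ⟨2 * A.dim - 1, by omega⟩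
  rw [hr, Nat.add_sub_cancel, prod_pow_apply_prime_pow hp]

/-- **A complex elliptic curve has exactly `1 + p + ⋯ + pʲ` subgroups of order `pʲ`** (`= σ₁(pʲ)`, the tree's `natCard_subgroup_points_natCard_eq_of_dim_eq_one` at a prime power,
in Gaussian-binomial form `[j+1; 1]_p`). [cite: Zou2006, §1 (1.4)] [cite: Serre1973, Ch. VII §5.2 (65)] -/
theorem natCard_subgroup_points_natCard_eq_prime_pow_of_dim_eq_one {p : ℕ} (hp : p.Prime) (hA : A.dim = 1) (j : ℕ) :
    (Nat.card {H : Subgroup (A.Points ℂ) // Nat.card H = p ^ j} : ℤ) = ∑ i ∈ range (j + 1), (p : ℤ) ^ i := by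
  rw [natCard_subgroup_points_natCard_eq_prime_pow_eq_qBinomial A hp (by omega) j, hA, show 2 * 1 - 1 + j = j + 1 by omega, show 2 * 1 - 1 = 1 from rfl,
    qBinomial_succ_one_eq_sum]

end Literature.AlgebraicGeometry.HodgeTheory.AbelianVariety

end
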